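import Literature.AlgebraicGeometry.Resolution.RegularCentreBlowupOrder
import Literature.AlgebraicGeometry.Resolution.NearPointsOneVariable
import Literature.AlgebraicGeometry.Resolution.NearPointsHomogeneous
import Literature.AlgebraicGeometry.Resolution.OrderGenerizationCoheightOne
import Literature.AlgebraicGeometry.Resolution.HironakaDirectrixSpan
import Mathlib.Logic.Equiv.Fin.Basic
import HarnessLib

/-!
# Near points over a curve centre: all initial forms are `c_F (Y_l − a Y_j)^μ` (CoP1, Lemma 4.3 (2))

Topic: `Literature/AlgebraicGeometry/Resolution`. [CoP1] = Cossart–Piltant, J. Algebra 320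
(2008), Lemma 4.3 (2), p. 8: "If `τ(x) = 2` and `Y` is a curve, then no `x′ ∈ q⁻¹(x)` is near
`x`", which "follows easily from (10) and (11)": for the blowing up along a curve
`Y = V(y_1, y_2)` through `x`, every `f ∈ J_x` has `in_x f = F(Y_1, Y_2)` ((10)) and weak
transform `y_j^{-μ} f ≡ F(Y_j := 1) mod 𝔪_x B_j` on the chart `B_j` ((11)), a polynomial of
degree `≤ μ` in the one fibre variable; if `x′` over `x` is near (`ord_{x′} J′ = μ`), it
vanishes to order `μ` at the point of `x′` on the fibre line `q⁻¹(x) ≅ ℙ¹_{k(x)}`.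
PROVED here at the level of the chart algebra `B_j = R[P/c_j]` of a local ring `R` along a
quasi-regular sequence `c = (c_1, c_2) ⊆ 𝔪` (the centre `P = (c)` of codimension `2`):

* `exists_map_residue_eq_C_mul_X_sub_C_mul_X_pow` — for a prime `𝔴 ⊇ 𝔪 B_j` of the chart and a
  form `F` of degree `μ ≥ 1` with `F̄ ≠ 0` and `F(e) ∈ 𝔴^μ (B_j)_𝔴` ("near"): the point of `𝔴`
  on the fibre line is the RATIONAL point `T_l = a` and `F̄ = c_F (Y_l − a Y_j)^μ`
  (`NearPointsOneVariable.lean`, `NearPointsHomogeneous.lean`);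
* `exists_forall_map_residue_eq_C_mul_X_sub_C_mul_X_pow`,
  `exists_forall_mem_initialForms_eq_C_mul_pow` — **hence one `a ∈ k(x)` works for all near
  forms at once: if `F(e) ∈ 𝔴^μ (B_j)_𝔴` for every form `F` of degree `μ` with `F(c) ∈ J`, then
  `cl_μ(J) ⊆ {c (Y_l − a Y_j)^μ}` (initial forms with respect to `c`)**;
* `hironakaTau_le_one_of_forall_eq_C_mul_pow`, `hironakaTauAt_le_one_of_forall_mem_pow` —
  **so `cl_μ(J) ⊆ k(x)[Y_l − a Y_j]` and `τ ≤ 1`** (contradicting `τ(x) = 2`; the passage to a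
  full regular system of parameters and to schemes is assembled in later files).

## Sources

* V. Cossart, O. Piltant, J. Algebra 320 (2008) 1051–1082, Lemma 4.3 (2) with (10)–(11), p. 8.
  [CossartPiltant2008]
* H. Hironaka, Ann. of Math. 79 (1964), Ch. III §4 (near points lie on the projective space of
  the directrix) — background.
-/

noncomputable section

open IsLocalRing MvPolynomial

namespace Literature.AlgebraicGeometry.Resolution

universe u

/-! ## Linear algebra: sets of `μ`-th powers of one linear form have `τ ≤ 1` -/

section LinearForm

variable (k : Type u) [Field k] {d : ℕ}

omit [Field k] in
/-- `(T_i − a) = (T_i − b)` as ideals of a polynomial ring forces `a = b`. [folklore] -/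
theorem eq_of_span_X_sub_C_eq {k : Type*} [CommRing k] {σ : Type*} (i : σ) {a b : k}
    (h : Ideal.span {(X i - C a : MvPolynomial σ k)} = Ideal.span {X i - C b}) : a = b := by
  have hmem : (X i - C a : MvPolynomial σ k) ∈ Ideal.span {(X i - C b : MvPolynomial σ k)} :=
    h ▸ Ideal.mem_span_singleton_self _
  obtain ⟨q, hq⟩ := Ideal.mem_span_singleton'.mp hmem
  have h1 : eval (fun _ => b) (q * (X i - C b)) = eval (fun _ => b) (X i - C a : MvPolynomial σ k) := by
    rw [hq]
  simp only [map_mul, map_sub, eval_X, eval_C, sub_self, mul_zero] at h1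
  exact (sub_eq_zero.mp h1.symm).symm

/-- The linear form `e_l^* − a e_j^*` gives the polynomial `Y_l − a Y_j`. [folklore] -/
theorem linearFormPoly_proj_sub_smul_proj (l j : Fin d) (a : k) :
    linearFormPoly k ((LinearMap.proj l : Module.Dual k (Fin d → k)) - a • LinearMap.proj j) =
      X l - C a * X j := by
  rw [← linearFormPolyₗ_apply, map_sub, map_smul, linearFormPolyₗ_apply, linearFormPolyₗ_apply,
    linearFormPoly_proj, linearFormPoly_proj, smul_eq_C_mul]

/-- `c (Y_l − a Y_j)^μ ∈ k[Y_l − a Y_j]`. [folklore] -/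
theorem C_mul_X_sub_C_mul_X_pow_mem_linearFormsSubalgebra (l j : Fin d) (a c₀ : k) (μ : ℕ) :
    (C c₀ * (X l - C a * X j) ^ μ : MvPolynomial (Fin d) k) ∈ linearFormsSubalgebra k
      (k ∙ ((LinearMap.proj l : Module.Dual k (Fin d → k)) - a • LinearMap.proj j)) := by
  have hgen : (X l - C a * X j : MvPolynomial (Fin d) k) ∈ linearFormsSubalgebra k
      (k ∙ ((LinearMap.proj l : Module.Dual k (Fin d → k)) - a • LinearMap.proj j)) := by
    rw [← linearFormPoly_proj_sub_smul_proj k l j a]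
    exact Algebra.subset_adjoin ⟨_, Submodule.mem_span_singleton_self _, rfl⟩
  rw [← smul_eq_C_mul]
  exact Subalgebra.smul_mem _ (pow_mem hgen μ) c₀

/-- **A set of multiples of `μ`-th powers of one linear form `Y_l − a Y_j` has `τ ≤ 1`**: it lies
in `k[Y_l − a Y_j]`, and the directrix is the smallest space of linear forms `T'` with
`S ⊆ k[T']`. [cite: CossartPiltant2008, Lemma 4.3 (2)] -/
theorem hironakaTau_le_one_of_forall_eq_C_mul_pow {S : Set (MvPolynomial (Fin d) k)} (l j : Fin d)
    (a : k) (μ : ℕ) (hS : ∀ G ∈ S, ∃ c₀ : k, G = C c₀ * (X l - C a * X j) ^ μ) :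
    hironakaTau k S ≤ 1 := by
  have hsub : S ⊆ linearFormsSubalgebra k
      (k ∙ ((LinearMap.proj l : Module.Dual k (Fin d → k)) - a • LinearMap.proj j)) := by
    intro G hG
    obtain ⟨c₀, rfl⟩ := hS G hG
    exact C_mul_X_sub_C_mul_X_pow_mem_linearFormsSubalgebra k l j a c₀ μ
  refine (hironakaTau_le_finrank_of_subset k hsub).trans ?_
  refine (finrank_span_le_card ({(LinearMap.proj l : Module.Dual k (Fin d → k)) -
    a • LinearMap.proj j} : Set (Module.Dual k (Fin d → k)))).trans ?_
  simp

end LinearForm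

/-! ## The chart computation over a curve centre -/

section Chart

variable {R : Type u} [CommRing R] [IsLocalRing R] (c : Fin 2 → R) (j : Fin 2) {l : Fin 2}
  (hl : l ≠ j)

/-- **[CoP1] Lemma 4.3 (2), one near form.** Let `c = (c_1, c_2) ⊆ 𝔪` be quasi-regular in the
local ring `R`, `B_j` the `j`-th chart of the blowing up of `P = (c)`,
`ρ : B_j → k[T_l]` (`k = R/𝔪`, `l ≠ j`) the reduction modulo `𝔪 B_j` (`exists_chartResidueMap`),
`𝔴 ⊇ 𝔪 B_j` a prime of the chart (a point of the fibre line over the closed point) and `F` a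
form of degree `μ ≥ 1` in `Y_1, Y_2` with `F̄ ≠ 0` whose weak transform `F(e)` lies in
`𝔴^μ (B_j)_𝔴` (the point is "near" for `F`). Then the point is the rational point `T_l = a` of the
line, `ρ(𝔴) = (T_l − a)`, and `F̄ = c_F (Y_l − a Y_j)^μ`: by (11) `ρ(F(e)) = F̄(Y_j := 1)` is a
non-zero polynomial of degree `≤ μ` lying in `𝔮^μ k[T]_𝔮`, `𝔮 = ρ(𝔴)`.
[cite: CossartPiltant2008, Lemma 4.3 (2)] -/
theorem exists_map_residue_eq_C_mul_X_sub_C_mul_X_pow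
    {ρ : chartRing c j →+* MvPolynomial {i : Fin 2 // i ≠ j} (ResidueField R)}
    (hρsurj : Function.Surjective ρ)
    (hρker : RingHom.ker ρ = (maximalIdeal R).map (chartBase c j))
    (hρF : ∀ F : MvPolynomial (Fin 2) R,
      ρ (MvPolynomial.eval₂Hom (chartBase c j) (fun i => chartGen c j i) F) =
        MvPolynomial.map (residue R) (dehomogenize j F))
    {F : MvPolynomial (Fin 2) R} {μ : ℕ} (hμ : 1 ≤ μ) (hF : F.IsHomogeneous μ)
    (hF0 : MvPolynomial.map (residue R) F ≠ 0)
    (𝔴 : Ideal (chartRing c j)) [𝔴.IsPrime] (h𝔴 : (maximalIdeal R).map (chartBase c j) ≤ 𝔴)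
    (hnear : (algebraMap (chartRing c j) (Localization.AtPrime 𝔴) :
        chartRing c j →+* Localization.AtPrime 𝔴)
        (MvPolynomial.eval₂Hom (chartBase c j) (fun i => chartGen c j i) F) ∈
      maximalIdeal (Localization.AtPrime 𝔴) ^ μ) :
    ∃ a c₀ : ResidueField R,
      𝔴.map ρ = Ideal.span {(X ⟨l, hl⟩ - C a : MvPolynomial {i : Fin 2 // i ≠ j} (ResidueField R))} ∧
      MvPolynomial.map (residue R) F = C c₀ * (X l - C a * X j) ^ μ := by
  classical
  haveI : Unique {i : Fin 2 // i ≠ j} := (finSuccAboveEquiv j).symm.unique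
  -- `g = F̄(Y_j := 1) ≠ 0`, of degree `≤ μ`
  have hg0 : MvPolynomial.map (residue R) (dehomogenize j F) ≠ 0 := by
    rw [map_dehomogenize]
    exact dehomogenize_ne_zero_of_isHomogeneous j (hF.map _) hF0
  have hgdeg : (MvPolynomial.map (residue R) (dehomogenize j F)).totalDegree ≤ μ :=
    (totalDegree_map_le _ _).trans ((totalDegree_dehomogenize_le j F).trans hF.totalDegree_le)
  -- the prime `𝔮 = ρ(𝔴)` of `k[T]` and the local homomorphism `(B_j)_𝔴 → k[T]_𝔮`
  have hker : RingHom.ker ρ ≤ 𝔴 := hρker.trans_le h𝔴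
  haveI h𝔮 : (𝔴.map ρ).IsPrime := Ideal.map_isPrime_of_surjective hρsurj hker
  have hcomap : 𝔴 = (𝔴.map ρ).comap ρ := by
    rw [Ideal.comap_map_of_surjective ρ hρsurj, ← RingHom.ker_eq_comap_bot, sup_eq_left.mpr hker]
  -- near: `g ∈ 𝔮^μ k[T]_𝔮`, i.e. `s g ∈ 𝔮^μ` for some `s ∉ 𝔮`
  have hnear' : algebraMap _ (Localization.AtPrime (𝔴.map ρ))
      (MvPolynomial.map (residue R) (dehomogenize j F)) ∈
      maximalIdeal (Localization.AtPrime (𝔴.map ρ)) ^ μ := by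
    rw [← hρF F, ← Localization.localRingHom_to_map 𝔴 (𝔴.map ρ) ρ hcomap]
    exact Ideal.map_maximalIdeal_pow_le (Localization.localRingHom 𝔴 (𝔴.map ρ) ρ hcomap) μ
      (Ideal.mem_map_of_mem _ hnear)
  obtain ⟨s, hs, hsg⟩ := exists_mul_mem_pow_of_algebraMap_mem_maximalIdeal_pow (𝔴.map ρ)
    (Localization.AtPrime (𝔴.map ρ)) hnear'
  -- `𝔮 ≠ 0` since `g ≠ 0`
  have h𝔮0 : 𝔴.map ρ ≠ ⊥ := by
    intro h0
    rw [h0] at hs hsg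
    have hsg' := Ideal.pow_le_self (by omega : μ ≠ 0) hsg
    rw [Ideal.mem_bot] at hsg'
    rcases mul_eq_zero.mp hsg' with h | h
    · exact hs (by rw [h]; exact Ideal.zero_mem _)
    · exact hg0 h
  -- one variable: `𝔮 = (T − a)`, `g = c₀ (T − a)^μ`; homogenise
  obtain ⟨a, c₀, hqa, hga⟩ := MvPolynomial.exists_eq_C_mul_X_sub_C_pow_of_mul_mem_pow hg0 hμ hgdeg
    (𝔴.map ρ) h𝔮0 hs hsg
  have hdef : (default : {i : Fin 2 // i ≠ j}) = ⟨l, hl⟩ := Subsingleton.elim _ _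
  rw [hdef] at hqa hga
  refine ⟨a, c₀, hqa, ?_⟩
  rw [map_dehomogenize] at hga
  exact eq_C_mul_X_sub_C_mul_X_pow_of_dehomogenize_eq j hl (hF.map _) hga

include hl in
/-- **[CoP1] Lemma 4.3 (2), all near forms at once.** In the same setting, one `a ∈ k` serves
for every form: if `F(e) ∈ 𝔴^μ (B_j)_𝔴` for all `F` in a set `S` of forms of degree `μ ≥ 1`,
then there is `a ∈ k` with `F̄ = c_F (Y_l − a Y_j)^μ` for every `F ∈ S` (the rational point
`T_l = a` of the fibre line under `𝔴` does not depend on `F`; forms with `F̄ = 0` take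
`c_F = 0`). [cite: CossartPiltant2008, Lemma 4.3 (2)] -/
theorem exists_forall_map_residue_eq_C_mul_X_sub_C_mul_X_pow (hcq : IsQuasiRegular c)
    (hcm : ∀ i, c i ∈ maximalIdeal R) (𝔴 : Ideal (chartRing c j)) [𝔴.IsPrime]
    (h𝔴 : (maximalIdeal R).map (chartBase c j) ≤ 𝔴) {μ : ℕ} (hμ : 1 ≤ μ)
    (S : Set (MvPolynomial (Fin 2) R))
    (hS : ∀ F ∈ S, F.IsHomogeneous μ ∧
      (algebraMap (chartRing c j) (Localization.AtPrime 𝔴) :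
          chartRing c j →+* Localization.AtPrime 𝔴)
          (MvPolynomial.eval₂Hom (chartBase c j) (fun i => chartGen c j i) F) ∈
        maximalIdeal (Localization.AtPrime 𝔴) ^ μ) :
    ∃ a : ResidueField R, ∀ F ∈ S, ∃ c₀ : ResidueField R,
      MvPolynomial.map (residue R) F = C c₀ * (X l - C a * X j) ^ μ := by
  classical
  obtain ⟨ρ, hρsurj, hρker, hρF⟩ :
      ∃ ρ : chartRing c j →+* MvPolynomial {i : Fin 2 // i ≠ j} (ResidueField R),
        Function.Surjective ρ ∧ RingHom.ker ρ = (maximalIdeal R).map (chartBase c j) ∧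
        ∀ F : MvPolynomial (Fin 2) R,
          ρ (MvPolynomial.eval₂Hom (chartBase c j) (fun i => chartGen c j i) F) =
            MvPolynomial.map (residue R) (dehomogenize j F) :=
    exists_chartResidueMap c j hcq hcm
  have key : ∀ F ∈ S, MvPolynomial.map (residue R) F ≠ 0 →
      ∃ a c₀ : ResidueField R,
        𝔴.map ρ = Ideal.span {(X ⟨l, hl⟩ - C a : MvPolynomial {i : Fin 2 // i ≠ j} (ResidueField R))} ∧
        MvPolynomial.map (residue R) F = C c₀ * (X l - C a * X j) ^ μ :=
    fun F hF hF0 => exists_map_residue_eq_C_mul_X_sub_C_mul_X_pow c j hl hρsurj hρker hρF hμ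
      (hS F hF).1 hF0 𝔴 h𝔴 (hS F hF).2
  have triv : ∀ (a : ResidueField R) (F : MvPolynomial (Fin 2) R),
      MvPolynomial.map (residue R) F = 0 → ∃ c₀ : ResidueField R,
        MvPolynomial.map (residue R) F = C c₀ * (X l - C a * X j) ^ μ :=
    fun a F h0 => ⟨0, by rw [h0, C_0, zero_mul]⟩
  by_cases h : ∃ a : ResidueField R,
      𝔴.map ρ = Ideal.span {(X ⟨l, hl⟩ - C a : MvPolynomial {i : Fin 2 // i ≠ j} (ResidueField R))}
  · obtain ⟨a, ha⟩ := h
    refine ⟨a, fun F hF => ?_⟩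
    by_cases hF0 : MvPolynomial.map (residue R) F = 0
    · exact triv a F hF0
    obtain ⟨a', c₀, ha', hF'⟩ := key F hF hF0
    rw [ha] at ha'
    rw [eq_of_span_X_sub_C_eq _ ha']
    exact ⟨c₀, hF'⟩
  · refine ⟨0, fun F hF => ?_⟩
    by_cases hF0 : MvPolynomial.map (residue R) F = 0
    · exact triv 0 F hF0
    obtain ⟨a', c₀, ha', -⟩ := key F hF hF0
    exact absurd ⟨a', ha'⟩ h

include hl in
/-- **[CoP1] Lemma 4.3 (2) for the initial forms with respect to the centre parameters**: if
every form `F` of degree `μ ≥ 1` in `c_1, c_2` with `F(c) ∈ J` has weak transform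
`F(e) ∈ 𝔴^μ (B_j)_𝔴` (as happens when the point `𝔴` of the blowing up is near, `J ⊆ P^μ`), then
for one `a ∈ k`, **every initial form of `J` (with respect to `c`) is `c_G (Y_l − a Y_j)^μ`.**
[cite: CossartPiltant2008, Lemma 4.3 (2)] -/
theorem exists_forall_mem_initialForms_eq_C_mul_pow (hcq : IsQuasiRegular c)
    (hcm : ∀ i, c i ∈ maximalIdeal R) (𝔴 : Ideal (chartRing c j)) [𝔴.IsPrime]
    (h𝔴 : (maximalIdeal R).map (chartBase c j) ≤ 𝔴) {J : Ideal R} {μ : ℕ} (hμ : 1 ≤ μ)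
    (hJ : ∀ F : MvPolynomial (Fin 2) R, F.IsHomogeneous μ → MvPolynomial.eval c F ∈ J →
      (algebraMap (chartRing c j) (Localization.AtPrime 𝔴) :
          chartRing c j →+* Localization.AtPrime 𝔴)
          (MvPolynomial.eval₂Hom (chartBase c j) (fun i => chartGen c j i) F) ∈
        maximalIdeal (Localization.AtPrime 𝔴) ^ μ) :
    ∃ a : ResidueField R, ∀ G ∈ initialForms c J μ, ∃ c₀ : ResidueField R,
      G = C c₀ * (X l - C a * X j) ^ μ := by
  obtain ⟨a, ha⟩ := exists_forall_map_residue_eq_C_mul_X_sub_C_mul_X_pow c j hl hcq hcm 𝔴 h𝔴 hμ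
    {F : MvPolynomial (Fin 2) R | F.IsHomogeneous μ ∧ MvPolynomial.eval c F ∈ J}
    (fun F hF => ⟨hF.1, hJ F hF.1 hF.2⟩)
  refine ⟨a, fun G hG => ?_⟩
  obtain ⟨F, hF, hFJ, rfl⟩ := (mem_initialForms_iff c).mp hG
  exact ha F ⟨hF, hFJ⟩

include hl in
/-- **Hence `τ ≤ 1` for the initial forms with respect to the centre parameters**
(`cl_μ(J) ⊆ k[Y_l − a Y_j]`), which is how [CoP1] Lemma 4.3 (2) contradicts `τ(x) = 2`.
[cite: CossartPiltant2008, Lemma 4.3 (2)] -/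
theorem hironakaTauAt_le_one_of_forall_mem_pow (hcq : IsQuasiRegular c)
    (hcm : ∀ i, c i ∈ maximalIdeal R) (𝔴 : Ideal (chartRing c j)) [𝔴.IsPrime]
    (h𝔴 : (maximalIdeal R).map (chartBase c j) ≤ 𝔴) {J : Ideal R} {μ : ℕ} (hμ : 1 ≤ μ)
    (hJ : ∀ F : MvPolynomial (Fin 2) R, F.IsHomogeneous μ → MvPolynomial.eval c F ∈ J →
      (algebraMap (chartRing c j) (Localization.AtPrime 𝔴) :
          chartRing c j →+* Localization.AtPrime 𝔴)
          (MvPolynomial.eval₂Hom (chartBase c j) (fun i => chartGen c j i) F) ∈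
        maximalIdeal (Localization.AtPrime 𝔴) ^ μ) :
    hironakaTauAt c J μ ≤ 1 := by
  obtain ⟨a, ha⟩ := exists_forall_mem_initialForms_eq_C_mul_pow c j hl hcq hcm 𝔴 h𝔴 hμ hJ
  exact hironakaTau_le_one_of_forall_eq_C_mul_pow (ResidueField R) l j a μ ha

end Chart

end Literature.AlgebraicGeometry.Resolution

end
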